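import Summits.NavierStokesRegularity.FunctionalMining.NoGo.TopEigLatticeLineFibre
import HarnessLib

/-!
# FunctionalMining / NoGo — K56b: LATTICE-LINE SPREAD and NO ALIGNED RATIONAL FIBRE for (F2)
# witnesses — on EVERY closed lattice line (`K = latticeVec k`, `k ∈ ℤ³ ∖ {0}`):
# `(3 − ε) · ∫_{aligned} λ₁ ≤ 2 ∫ λ₁`; an `ε`-aligned closed lattice line carries `λ₁ = S = 0`;
# in EVERY direction: segment spread with a boundary term `≤ 2‖K‖‖v‖_∞`
# (second of two files; the line calculus is K56a `TopEigLatticeLineFibre`)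

HONEST FRAMING. Search for candidate a priori estimates; no regularity claim. Nothing about
Navier–Stokes is proved or asserted in this file. Cell `pub-nsfunc`, no-go seat (gen 52; v3 = the
v2 content split in two files under the 400-line rule of `lean/CONVENTIONS.md`). Static calculus
of smooth fields on the flat torus: constraints on the SHAPE of a killing family for door (b)/(F2)
of `NOGO.md` — the extension of K54 (FRAME SPREAD, `∫_{T³} eᵀSe = 0`) and K55 (LINE SPREAD on
closed COORDINATE lines) to the closed geodesics of every RATIONAL direction and, with an explicit
boundary term, to every segment of every direction. Inputs from K56a: the segment FTC
`LatticeLineFibre.intervalIntegral_quadStrain_line`, the zero mean on closed lattice lines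
`LatticeLineFibre.setIntegral_quadStrain_latticeLine_eq_zero` (= the tree's X-ray identity
`BiaxialEikonal.intervalIntegral_longitudinalStrain_eq_zero`, `BiaxialXRay.lean`), and the
`‖K‖²`-Rayleigh pair.

CONTENT (`v` smooth and divergence free on `T³`; `λ₁ = torusStrainTopEig v`; `γ(t) = x + proj (t • K)`;
section numbers continue K56a's § 1–§ 4).
§ 5 SPREAD. With `segmentAlignedSet v K ε x = {t | (1 − ε)‖K‖² λ₁(γ t) ≤ Kᵀ S(γ t) K}`:
**`segment_spread`** (EVERY `K`, every segment)
`(3 − ε)‖K‖² ∫_{(a,b] ∩ aligned} λ₁ ≤ 2‖K‖² ∫_{(a,b]} λ₁ + (⟪K, v(γ b)⟫ − ⟪K, v(γ a)⟫)`;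
**`latticeLine_spread`** (`K = latticeVec k`, `k ≠ 0`)
`(3 − ε) ∫_{(0,1] ∩ aligned} λ₁ ≤ 2 ∫_{(0,1]} λ₁`, ratio / complement / plateau forms
**`setIntegral_latticeLine_aligned_le`**, **`latticeLine_spread_compl`**,
**`latticeLine_plateau_aligned_measureReal_le`** (LINE MISALIGNMENT = LINE MASS is K56a's
`LatticeLineFibre.setIntegral_norm_sq_mul_top_sub_quadStrain_eq`).
§ 6 NO ALIGNED RATIONAL FIBRE **`topEig_eq_zero_on_aligned_latticeLine'`**: if along ONE closed
lattice line `K = latticeVec k ≠ 0` is everywhere `ε`-aligned with the top eigen-direction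
(`ε < 1`), then `λ₁ = 0` — hence `S = 0` (**`strainFlat_eq_zero_on_aligned_latticeLine`**) — at every
point `γ(t)`, `t ∈ ℝ`; contrapositive **`exists_misaligned_on_latticeLine`**.
§ 7 calibration **`quadStrain_latticeVec_single`**: `k = Pi.single i 1` gives `Kᵀ S K = Sᵢᵢ` (K55).

MEANING FOR (F2) (design rule (R13⁺⁺), records only). (a) Every statement of K55 holds on the
closed geodesics of EVERY RATIONAL DIRECTION (a dense set of directions), line by line: a killing
family spends, on every closed lattice line, at least the fraction `(1 − ε)/(3 − ε) − o(1)` of the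
line's `λ₁`-mass tilted against the line's own direction, and no closed lattice line is an aligned
fibre. (b) In EVERY direction, rational or not, alignment is a BOUNDARY-TERM quantity: on a plateau
`{λ₁ ≥ m}` a straight fibre along which the top direction stays `ε`-close to the fibre direction has
length at most `2‖v‖_∞/((1 − ε) m)` — the VELOCITY scale over the strain level; along a killing
family normalised by `Φ_q ≈ m^q` the texture of top directions must therefore turn on the scale
`‖v_n‖_∞ / m`, uniformly in direction and position, and the segment-spread excess over `2/(3 − ε)`
of the `λ₁`-mass is at most `2‖K‖‖v‖_∞` per segment independently of its length (a Birkhoff-type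
statement with NO equidistribution input; the irrational-direction torus average follows in pen by
unique ergodicity of the linear flow, not kernelised). CALIBRATION (records): the circularly
polarised laminate `(sin 2πx₃, cos 2πx₃, 0)` (`λ₁ ≡ π`, `‖v‖_∞ = 1`) passes every rule here — its
aligned fibres are horizontal segments of bounded length turning with `x₃` — and is nevertheless
heat-priced (`heatDissipation Φ₂ ≥ 8π² Φ₂`, laminate rigidity, tree
`TopEigLaminate.laminate_rigid_two_V'`): like (R11)–(R13⁺), the rule CONSTRAINS a killing family, it
does not select one. Nothing here bounds `heatDissipation`, so (F2) stays WANTED/OPEN and L-λ(q)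
OPEN for every real `q > 1`.
[ours = assembly; tree inputs by name through K56a (`BiaxialXRay`, `BiaxialContact`)]
FILING (prove seat g29, REQUEST #84b): declarations byte-identical to the no-go seat's staged `TopEigLatticeLineSpread.STAGING.lean` 5a64cd99f1f9dafc; this line is the only addition.
-/

noncomputable section

open MeasureTheory Set Filter Topology
open scoped InnerProductSpace

namespace Summit.NavierStokesRegularity.FunctionalMining
open Literature.Analysis Literature.Analysis.FunctionSpaces Literature.Analysis.FunctionSpaces.Torus
  Literature.Analysis.FluidPDE TopEig BiaxialEikonal

namespace TopEig

namespace LatticeLineSpread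

open LatticeLineFibre

variable {v : UnitAddTorus (Fin 3) → EuclideanSpace ℝ (Fin 3)}

/-! ## 5. Segment spread in every direction; lattice-line spread -/

/-- The LATTICE-LINE-ALIGNED SET of the vector `K` through the base point `x`: the parameters `t` at
which the Rayleigh defect of `K` is at most `ε ‖K‖² λ₁`, i.e.
`(1 − ε) ‖K‖² λ₁(x + proj (t • K)) ≤ Kᵀ S(x + proj (t • K)) K` (`ε = 0`, `K ≠ 0`: `K` is a top
eigenvector there). [ours] -/
def segmentAlignedSet (v : UnitAddTorus (Fin 3) → EuclideanSpace ℝ (Fin 3)) (K : EuclideanSpace ℝ (Fin 3))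
    (ε : ℝ) (x : UnitAddTorus (Fin 3)) : Set ℝ :=
  {t | (1 - ε) * ‖K‖ ^ 2 * torusStrainTopEig v (x + Torus.proj (t • K)) ≤
    ∑ i, ∑ j, K i * torusStrainMatrix v (x + Torus.proj (t • K)) i j * K j}

/-- The lattice-line-aligned set is measurable (closed). [ours, bookkeeping] -/
theorem measurableSet_segmentAlignedSet (hv : Torus.IsSmooth v) (K : EuclideanSpace ℝ (Fin 3)) (ε : ℝ)
    (x : UnitAddTorus (Fin 3)) : MeasurableSet (segmentAlignedSet v K ε x) :=
  measurableSet_le (continuous_const.mul (continuous_topEig_along hv K x)).measurable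
    (continuous_quadStrain_along hv K x).measurable

/-- **SEGMENT SPREAD IN EVERY DIRECTION.** For a smooth divergence-free `v` on `T³`, ANY vector `K`,
any real `ε`, every base point `x` and every parameter segment `(a, b]`:
`(3 − ε) ‖K‖² · ∫_{(a,b] ∩ aligned} λ₁ ≤ 2 ‖K‖² · ∫_{(a,b]} λ₁ + (⟪K, v(x + proj (b • K))⟫ − ⟪K, v(x + proj (a • K))⟫)`,
the boundary term being at most `2 ‖K‖ ‖v‖_∞` WHATEVER the length `b − a` (`abs_inner_sub_inner_le_norm_mul`).
Proof: `∫_{(a,b]} Kᵀ S K = boundary term = ∫_A + ∫_{Aᶜ}` with `Kᵀ S K ≥ (1 − ε)‖K‖²λ₁` on `A` and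
`≥ −2‖K‖²λ₁` off `A`. [ours] -/
theorem segment_spread (hv : Torus.IsSmooth v) (hdiv : Torus.IsDivFree v) (K : EuclideanSpace ℝ (Fin 3))
    (ε : ℝ) (x : UnitAddTorus (Fin 3)) {a b : ℝ} (hab : a ≤ b) :
    (3 - ε) * ‖K‖ ^ 2 * ∫ t in Ioc a b ∩ segmentAlignedSet v K ε x,
        torusStrainTopEig v (x + Torus.proj (t • K)) ≤
      2 * ‖K‖ ^ 2 * (∫ t in Ioc a b, torusStrainTopEig v (x + Torus.proj (t • K))) +
        (⟪K, v (x + Torus.proj (b • K))⟫_ℝ - ⟪K, v (x + Torus.proj (a • K))⟫_ℝ) := by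
  set A := segmentAlignedSet v K ε x with hA_def
  set L : ℝ → ℝ := fun t => torusStrainTopEig v (x + Torus.proj (t • K)) with hL_def
  set Q : ℝ → ℝ := fun t => ∑ i, ∑ j, K i * torusStrainMatrix v (x + Torus.proj (t • K)) i j * K j
    with hQ_def
  have hAm : MeasurableSet A := measurableSet_segmentAlignedSet hv K ε x
  have hLi : IntegrableOn L (Ioc a b) :=
    (continuous_topEig_along hv K x).integrableOn_Icc.mono_set Ioc_subset_Icc_self
  have hQi : IntegrableOn Q (Ioc a b) :=
    (continuous_quadStrain_along hv K x).integrableOn_Icc.mono_set Ioc_subset_Icc_self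
  have h0 : ∫ t in Ioc a b, Q t =
      ⟪K, v (x + Torus.proj (b • K))⟫_ℝ - ⟪K, v (x + Torus.proj (a • K))⟫_ℝ := by
    rw [← intervalIntegral.integral_of_le hab]
    exact intervalIntegral_quadStrain_line hv K x a b
  have hsplit : ∫ t in Ioc a b, Q t = (∫ t in Ioc a b ∩ A, Q t) + ∫ t in Ioc a b \ A, Q t :=
    (integral_inter_add_sdiff hAm hQi).symm
  have hLsplit : ∫ t in Ioc a b, L t = (∫ t in Ioc a b ∩ A, L t) + ∫ t in Ioc a b \ A, L t :=
    (integral_inter_add_sdiff hAm hLi).symm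
  have hA : ∫ t in Ioc a b ∩ A, (1 - ε) * ‖K‖ ^ 2 * L t ≤ ∫ t in Ioc a b ∩ A, Q t :=
    setIntegral_mono_on ((hLi.mono_set inter_subset_left).const_mul _)
      (hQi.mono_set inter_subset_left) (measurableSet_Ioc.inter hAm) fun t ht => ht.2
  have hAc : ∫ t in Ioc a b \ A, -2 * ‖K‖ ^ 2 * L t ≤ ∫ t in Ioc a b \ A, Q t :=
    setIntegral_mono_on ((hLi.mono_set sdiff_subset).const_mul _) (hQi.mono_set sdiff_subset)
      (measurableSet_Ioc.diff hAm) fun t _ => neg_two_mul_norm_sq_mul_top_le_quadStrain hv hdiv K _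
  rw [integral_const_mul] at hA hAc
  rw [hLsplit]
  linarith

/-- **LATTICE-LINE SPREAD.** For a smooth divergence-free `v` on `T³`, a NON-ZERO lattice direction
`K = latticeVec k`, any real `ε` and EVERY base point `x`, on the closed line
`t ↦ x + proj (t • K)`, `t ∈ (0, 1]`:
`(3 − ε) · ∫_{(0,1] ∩ aligned} λ₁ ≤ 2 · ∫_{(0,1]} λ₁`. Proof: `0 = ∫ Kᵀ S K = ∫_A + ∫_{Aᶜ}` with
`Kᵀ S K ≥ (1 − ε)‖K‖²λ₁` on `A` and `≥ −2‖K‖²λ₁` on `Aᶜ`; divide by `‖K‖² > 0`. [ours] -/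
theorem latticeLine_spread (hv : Torus.IsSmooth v) (hdiv : Torus.IsDivFree v) {k : Fin 3 → ℤ}
    (hk : k ≠ 0) (ε : ℝ) (x : UnitAddTorus (Fin 3)) :
    (3 - ε) * ∫ t in Ioc (0 : ℝ) 1 ∩ segmentAlignedSet v (Torus.latticeVec k) ε x,
        torusStrainTopEig v (x + Torus.proj (t • Torus.latticeVec k)) ≤
      2 * ∫ t in Ioc (0 : ℝ) 1, torusStrainTopEig v (x + Torus.proj (t • Torus.latticeVec k)) := by
  set K := Torus.latticeVec k with hK_def
  have hKn : 0 < ‖K‖ := norm_pos_iff.mpr (latticeVec_ne_zero hk)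
  have hK2 : 0 < ‖K‖ ^ 2 := by positivity
  have h := segment_spread hv hdiv K ε x zero_le_one
  have hb : ⟪K, v (x + Torus.proj ((1 : ℝ) • K))⟫_ℝ - ⟪K, v (x + Torus.proj ((0 : ℝ) • K))⟫_ℝ = 0 := by
    simp [hK_def]
  rw [hb, add_zero] at h
  have key : ‖K‖ ^ 2 * ((3 - ε) * ∫ t in Ioc (0 : ℝ) 1 ∩ segmentAlignedSet v K ε x,
      torusStrainTopEig v (x + Torus.proj (t • K))) ≤
      ‖K‖ ^ 2 * (2 * ∫ t in Ioc (0 : ℝ) 1, torusStrainTopEig v (x + Torus.proj (t • K))) := by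
    linarith
  exact le_of_mul_le_mul_left key hK2

/-- Ratio form (`ε < 3`): `∫_{(0,1] ∩ aligned} λ₁ ≤ 2/(3 − ε) · ∫_{(0,1]} λ₁`. [ours] -/
theorem setIntegral_latticeLine_aligned_le (hv : Torus.IsSmooth v) (hdiv : Torus.IsDivFree v)
    {k : Fin 3 → ℤ} (hk : k ≠ 0) {ε : ℝ} (hε : ε < 3) (x : UnitAddTorus (Fin 3)) :
    ∫ t in Ioc (0 : ℝ) 1 ∩ segmentAlignedSet v (Torus.latticeVec k) ε x,
        torusStrainTopEig v (x + Torus.proj (t • Torus.latticeVec k)) ≤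
      2 / (3 - ε) *
        ∫ t in Ioc (0 : ℝ) 1, torusStrainTopEig v (x + Torus.proj (t • Torus.latticeVec k)) := by
  rw [show 2 / (3 - ε) *
        ∫ t in Ioc (0 : ℝ) 1, torusStrainTopEig v (x + Torus.proj (t • Torus.latticeVec k)) =
      (2 * ∫ t in Ioc (0 : ℝ) 1, torusStrainTopEig v (x + Torus.proj (t • Torus.latticeVec k))) /
        (3 - ε) by ring, le_div_iff₀ (sub_pos.mpr hε), mul_comm]
  exact latticeLine_spread hv hdiv hk ε x

/-- **LATTICE-LINE SPREAD, complement form.** `(1 − ε) · ∫_{(0,1]} λ₁ ≤ (3 − ε) · ∫_{(0,1] ∖ aligned} λ₁`: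
on every closed lattice line at least the fraction `(1 − ε)/(3 − ε)` of the line's top-strain mass
sits where `K` is tilted against the top frame by a Rayleigh defect `> ε ‖K‖² λ₁`. [ours] -/
theorem latticeLine_spread_compl (hv : Torus.IsSmooth v) (hdiv : Torus.IsDivFree v) {k : Fin 3 → ℤ}
    (hk : k ≠ 0) (ε : ℝ) (x : UnitAddTorus (Fin 3)) :
    (1 - ε) * ∫ t in Ioc (0 : ℝ) 1, torusStrainTopEig v (x + Torus.proj (t • Torus.latticeVec k)) ≤
      (3 - ε) * ∫ t in Ioc (0 : ℝ) 1 \ segmentAlignedSet v (Torus.latticeVec k) ε x,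
        torusStrainTopEig v (x + Torus.proj (t • Torus.latticeVec k)) := by
  have hAm := measurableSet_segmentAlignedSet hv (Torus.latticeVec k) ε x
  have hLi : IntegrableOn
      (fun t : ℝ => torusStrainTopEig v (x + Torus.proj (t • Torus.latticeVec k))) (Ioc (0 : ℝ) 1) :=
    (continuous_topEig_along hv _ x).integrableOn_Icc.mono_set Ioc_subset_Icc_self
  have h := latticeLine_spread hv hdiv hk ε x
  have hLsplit := (integral_inter_add_sdiff hAm hLi).symm
  have hb : ∫ t in Ioc (0 : ℝ) 1 \ segmentAlignedSet v (Torus.latticeVec k) ε x,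
        torusStrainTopEig v (x + Torus.proj (t • Torus.latticeVec k)) =
      (∫ t in Ioc (0 : ℝ) 1, torusStrainTopEig v (x + Torus.proj (t • Torus.latticeVec k))) -
        ∫ t in Ioc (0 : ℝ) 1 ∩ segmentAlignedSet v (Torus.latticeVec k) ε x,
          torusStrainTopEig v (x + Torus.proj (t • Torus.latticeVec k)) := by
    linarith
  rw [hb]
  nlinarith

/-- **LATTICE-LINE PLATEAU READING.** If `m ≤ λ₁` on a measurable set `B ⊆ (0, 1]` of parameters and
`ε ≤ 3`, then `(3 − ε) · m · |aligned ∩ B| ≤ 2 · ∫_{(0,1]} λ₁`: on a flat closed lattice line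
(`λ₁ ≈ m`, `∫ λ₁ ≈ m`) the `K`-aligned portion has parameter length at most `2/(3 − ε)`. [ours] -/
theorem latticeLine_plateau_aligned_measureReal_le (hv : Torus.IsSmooth v) (hdiv : Torus.IsDivFree v)
    {k : Fin 3 → ℤ} (hk : k ≠ 0) {ε : ℝ} (hε : ε ≤ 3) (x : UnitAddTorus (Fin 3)) {B : Set ℝ}
    (hB : MeasurableSet B) (hBI : B ⊆ Ioc (0 : ℝ) 1) {m : ℝ}
    (hm : ∀ t ∈ B, m ≤ torusStrainTopEig v (x + Torus.proj (t • Torus.latticeVec k))) :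
    (3 - ε) * (m * volume.real (segmentAlignedSet v (Torus.latticeVec k) ε x ∩ B)) ≤
      2 * ∫ t in Ioc (0 : ℝ) 1, torusStrainTopEig v (x + Torus.proj (t • Torus.latticeVec k)) := by
  set K := Torus.latticeVec k with hK_def
  set A := segmentAlignedSet v K ε x with hA_def
  have hAm : MeasurableSet A := measurableSet_segmentAlignedSet hv K ε x
  have hLi : IntegrableOn (fun t : ℝ => torusStrainTopEig v (x + Torus.proj (t • K))) (Ioc (0 : ℝ) 1) :=
    (continuous_topEig_along hv K x).integrableOn_Icc.mono_set Ioc_subset_Icc_self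
  have hABvol : volume (A ∩ B) < ⊤ :=
    (measure_mono (inter_subset_right.trans hBI)).trans_lt measure_Ioc_lt_top
  have h1 : m * volume.real (A ∩ B) ≤ ∫ t in A ∩ B, torusStrainTopEig v (x + Torus.proj (t • K)) := by
    have hc : ∫ t in A ∩ B, m = m * volume.real (A ∩ B) := by
      rw [setIntegral_const, smul_eq_mul, mul_comm]
    rw [← hc]
    exact setIntegral_mono_on ((integrableOn_const_iff).2 (Or.inr hABvol))
      (hLi.mono_set (inter_subset_right.trans hBI)) (hAm.inter hB) fun t ht => hm t ht.2
  have h2 : ∫ t in A ∩ B, torusStrainTopEig v (x + Torus.proj (t • K)) ≤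
      ∫ t in Ioc (0 : ℝ) 1 ∩ A, torusStrainTopEig v (x + Torus.proj (t • K)) :=
    setIntegral_mono_set (hLi.mono_set inter_subset_left)
      (ae_of_all _ fun t => torusStrainTopEig_nonneg (d := Fin 3) (by simp) hv hdiv _)
      (ae_of_all _ fun t ht => ⟨hBI ht.2, ht.1⟩)
  have h3 := latticeLine_spread hv hdiv hk ε x
  have h3e : 0 ≤ 3 - ε := sub_nonneg.mpr hε
  nlinarith [mul_le_mul_of_nonneg_left (h1.trans h2) h3e]

/-! ## 6. No aligned rational fibre

(The tree's Rolle lemma `BiaxialEikonal.exists_longitudinalStrain_eq_zero` gives ONE point of every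
closed lattice line where `Kᵀ S K = 0`, hence `λ₁ = 0` there if `K` is `ε`-aligned at that point,
`ε < 1`; the statements below give `λ₁ = 0` on the WHOLE line, through the spread inequality.) -/

/-- If along the whole closed lattice line through `x` in the direction `K = latticeVec k ≠ 0` the
vector `K` is `ε`-aligned with the top frame for some `ε < 1` (at every parameter `t ∈ (0, 1]`), then
`∫₀¹ λ₁ = 0` on that line. [ours] -/
theorem setIntegral_topEig_latticeLine_eq_zero_of_aligned (hv : Torus.IsSmooth v)
    (hdiv : Torus.IsDivFree v) {k : Fin 3 → ℤ} (hk : k ≠ 0) {ε : ℝ} (hε : ε < 1)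
    {x : UnitAddTorus (Fin 3)}
    (h : ∀ t ∈ Ioc (0 : ℝ) 1, (1 - ε) * ‖Torus.latticeVec k‖ ^ 2 *
        torusStrainTopEig v (x + Torus.proj (t • Torus.latticeVec k)) ≤
      ∑ i, ∑ j, Torus.latticeVec k i *
        torusStrainMatrix v (x + Torus.proj (t • Torus.latticeVec k)) i j * Torus.latticeVec k j) :
    ∫ t in Ioc (0 : ℝ) 1, torusStrainTopEig v (x + Torus.proj (t • Torus.latticeVec k)) = 0 := by
  have hset : Ioc (0 : ℝ) 1 ∩ segmentAlignedSet v (Torus.latticeVec k) ε x = Ioc (0 : ℝ) 1 :=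
    inter_eq_left.mpr fun t ht => h t ht
  have hsp := latticeLine_spread hv hdiv hk ε x
  rw [hset] at hsp
  have hnn : 0 ≤ ∫ t in Ioc (0 : ℝ) 1, torusStrainTopEig v (x + Torus.proj (t • Torus.latticeVec k)) :=
    setIntegral_nonneg measurableSet_Ioc fun t _ =>
      torusStrainTopEig_nonneg (d := Fin 3) (by simp) hv hdiv _
  nlinarith

/-- **NO ALIGNED RATIONAL FIBRE.** If along the whole closed lattice line through `x` in the direction
`K = latticeVec k ≠ 0` the vector `K` is `ε`-aligned with the top eigen-direction for some `ε < 1`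
(`(1 − ε) ‖K‖² λ₁ ≤ Kᵀ S K` at every parameter `t ∈ (0, 1]`, hence at every real `t` by
periodicity), then `λ₁ = 0` at EVERY point `x + proj (t • K)`, `t ∈ [0, 1]`, of that line (a continuous
non-negative function with zero integral). [ours] -/
theorem topEig_eq_zero_on_aligned_latticeLine (hv : Torus.IsSmooth v) (hdiv : Torus.IsDivFree v)
    {k : Fin 3 → ℤ} (hk : k ≠ 0) {ε : ℝ} (hε : ε < 1) {x : UnitAddTorus (Fin 3)}
    (h : ∀ t ∈ Ioc (0 : ℝ) 1, (1 - ε) * ‖Torus.latticeVec k‖ ^ 2 *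
        torusStrainTopEig v (x + Torus.proj (t • Torus.latticeVec k)) ≤
      ∑ i, ∑ j, Torus.latticeVec k i *
        torusStrainMatrix v (x + Torus.proj (t • Torus.latticeVec k)) i j * Torus.latticeVec k j)
    {t : ℝ} (ht : t ∈ Icc (0 : ℝ) 1) :
    torusStrainTopEig v (x + Torus.proj (t • Torus.latticeVec k)) = 0 := by
  have hint := setIntegral_topEig_latticeLine_eq_zero_of_aligned hv hdiv hk hε h
  rw [← intervalIntegral.integral_of_le zero_le_one] at hint
  have hnn : ∀ s : ℝ, 0 ≤ torusStrainTopEig v (x + Torus.proj (s • Torus.latticeVec k)) := fun s =>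
    torusStrainTopEig_nonneg (d := Fin 3) (by simp) hv hdiv _
  by_contra hne
  have hpos : 0 < torusStrainTopEig v (x + Torus.proj (t • Torus.latticeVec k)) :=
    lt_of_le_of_ne (hnn t) (Ne.symm hne)
  have hlt := intervalIntegral.integral_lt_integral_of_continuousOn_of_le_of_exists_lt zero_lt_one
    continuousOn_const (continuous_topEig_along hv (Torus.latticeVec k) x).continuousOn
    (fun s _ => hnn s) ⟨t, ht, hpos⟩
  rw [intervalIntegral.integral_const, hint] at hlt
  simp at hlt

/-- The same at EVERY real parameter `t` (the line is closed with period `1`). [ours] -/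
theorem topEig_eq_zero_on_aligned_latticeLine' (hv : Torus.IsSmooth v) (hdiv : Torus.IsDivFree v)
    {k : Fin 3 → ℤ} (hk : k ≠ 0) {ε : ℝ} (hε : ε < 1) {x : UnitAddTorus (Fin 3)}
    (h : ∀ t ∈ Ioc (0 : ℝ) 1, (1 - ε) * ‖Torus.latticeVec k‖ ^ 2 *
        torusStrainTopEig v (x + Torus.proj (t • Torus.latticeVec k)) ≤
      ∑ i, ∑ j, Torus.latticeVec k i *
        torusStrainMatrix v (x + Torus.proj (t • Torus.latticeVec k)) i j * Torus.latticeVec k j)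
    (t : ℝ) : torusStrainTopEig v (x + Torus.proj (t • Torus.latticeVec k)) = 0 := by
  have hper : Torus.proj (t • Torus.latticeVec k) = Torus.proj (Int.fract t • Torus.latticeVec k) := by
    have h1 := proj_add_intCast_smul_latticeVec (Int.fract t) ⌊t⌋ k
    rw [Int.fract_add_floor] at h1
    exact h1
  rw [hper]
  exact topEig_eq_zero_on_aligned_latticeLine hv hdiv hk hε h
    ⟨Int.fract_nonneg t, (Int.fract_lt_one t).le⟩

/-- Contrapositive, the form used as a design rule: if `λ₁ > 0` somewhere on a closed lattice line,
then for every `ε < 1` the direction `K` of the line is tilted against the top frame by a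
Rayleigh defect `> ε ‖K‖² λ₁` at some parameter `t ∈ (0, 1]` of that line. [ours] -/
theorem exists_misaligned_on_latticeLine (hv : Torus.IsSmooth v) (hdiv : Torus.IsDivFree v)
    {k : Fin 3 → ℤ} (hk : k ≠ 0) {ε : ℝ} (hε : ε < 1) {x : UnitAddTorus (Fin 3)}
    (hpos : ∃ t : ℝ, 0 < torusStrainTopEig v (x + Torus.proj (t • Torus.latticeVec k))) :
    ∃ t ∈ Ioc (0 : ℝ) 1, ∑ i, ∑ j, Torus.latticeVec k i *
        torusStrainMatrix v (x + Torus.proj (t • Torus.latticeVec k)) i j * Torus.latticeVec k j <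
      (1 - ε) * ‖Torus.latticeVec k‖ ^ 2 *
        torusStrainTopEig v (x + Torus.proj (t • Torus.latticeVec k)) := by
  by_contra hcon
  simp only [not_exists, not_and, not_lt] at hcon
  obtain ⟨t, ht⟩ := hpos
  have h0 := topEig_eq_zero_on_aligned_latticeLine' hv hdiv hk hε hcon t
  linarith

/-- … and then the whole strain vanishes along that line (`‖S‖ ≤ 6 λ₁` for symmetric trace-free
tensors, tree `TopEig.norm_strainFlat_le`): an aligned rational fibre carries NO strain. [ours] -/
theorem strainFlat_eq_zero_on_aligned_latticeLine (hv : Torus.IsSmooth v) (hdiv : Torus.IsDivFree v)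
    {k : Fin 3 → ℤ} (hk : k ≠ 0) {ε : ℝ} (hε : ε < 1) {x : UnitAddTorus (Fin 3)}
    (h : ∀ t ∈ Ioc (0 : ℝ) 1, (1 - ε) * ‖Torus.latticeVec k‖ ^ 2 *
        torusStrainTopEig v (x + Torus.proj (t • Torus.latticeVec k)) ≤
      ∑ i, ∑ j, Torus.latticeVec k i *
        torusStrainMatrix v (x + Torus.proj (t • Torus.latticeVec k)) i j * Torus.latticeVec k j)
    (t : ℝ) : StrainL4.strainFlat v (x + Torus.proj (t • Torus.latticeVec k)) = 0 := by
  have hlam : lam (StrainL4.strainFlat v (x + Torus.proj (t • Torus.latticeVec k))) = 0 := by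
    rw [lam_strainFlat]
    exact topEig_eq_zero_on_aligned_latticeLine' hv hdiv hk hε h t
  have hn := norm_strainFlat_le hv hdiv (x + Torus.proj (t • Torus.latticeVec k))
  rw [hlam, mul_zero] at hn
  exact norm_le_zero_iff.1 hn

/-! ## 7. Calibration: coordinate axes are the lattice directions `eᵢ = latticeVec (single i 1)` -/

/-- At a standard basis vector the Rayleigh sum is the diagonal strain entry: `eᵢᵀ S eᵢ = Sᵢᵢ`
(so K55's coordinate-line statements are the case `k = Pi.single i 1` of the present ones).
[ours, bookkeeping] -/
theorem quadStrain_latticeVec_single (v : UnitAddTorus (Fin 3) → EuclideanSpace ℝ (Fin 3))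
    (y : UnitAddTorus (Fin 3)) (i : Fin 3) :
    ∑ a, ∑ b, Torus.latticeVec (Pi.single i 1 : Fin 3 → ℤ) a * torusStrainMatrix v y a b *
        Torus.latticeVec (Pi.single i 1 : Fin 3 → ℤ) b = torusStrainMatrix v y i i := by
  simp [Torus.latticeVec_apply, Pi.single_apply]

end LatticeLineSpread

end TopEig

end Summit.NavierStokesRegularity.FunctionalMining
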